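import Summits.BirchSwinnertonDyer.BirchSwinnertonDyer.Theorems.PrintCFramBottomClassIndexLawFiveLeFlipRungFourier
import HarnessLib

/-!
# Crux `PrintCFram.BottomClassIndexLawFiveLe` (stmt-BirchSwinnertonDyer-20372), line `eisenstein-resource-bdp-line`,
# registry v27 `stub_flipRung` — typing item (T1): THE FINITE FOURIER LEMMA OF THE FLIPPED-CUSP RUNG, part 2:
# the CUT IDENTITY and the FLIPPED-CUSP MOMENT `S(ξ)`
# (cell `bsd-print-cfram`, width seat `bsd-line-cfram-p1-w6` g9; THEOREMS ONLY, `--supports` 20372; BSD is not proved by any of this)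

HONEST FRAMING. Nothing here is a statement about BSD or about modular forms; no registered stub is closed. Sequel of
`…FlipRungFourier` (§1–§3 there). With the weight in closed form
`h_σ(j) = ((q − 1 if q ∣ j else −1) + σ·J(−j | q)·g_q)/2`, `g_q = gaussSum (quadraticChar (ZMod q))_ℂ (stdAddChar)`:

* §4 **`sum_legendreClassWeight_mul_stdAddChar_sq`** — THE CUT IDENTITY (Fourier inversion for the Legendre-class cut):
  `∑_{j mod q²} (h_σ(j)/q²)·e(jn/q²) = 1` if `q ∥ n ∧ J(n/q | q) = σ`, else `0` — i.e. with `b(j) := h_σ(j)/q²` the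
  translate-average `∑_j b(j) f(z + j/q²)` of `f = ∑ a(n)e(nz)` is `P_σ f = ∑_{q ∥ n, J(n/q|q) = σ} a(n) e(nz)`
  (LEAD g14 crux notes §2.1, definition of `P_σ`); inner sum `sum_legendreClassWeight_mul_stdAddChar_mod`.
* §5 **`flipMoment_eq`** — THE FLIPPED-CUSP MOMENT: for `c : ℤ` and `y : ℤ/q²ℤ → ℤ/q²ℤ` with `c·j·y_j = −1` on units
  (the matrix-factorisation output `M²·j·y_j ≡ −1 (mod q²)` of T2, `c = M²`),
  `S(ξ) := ∑_{j ∈ (ℤ/q²ℤ)ˣ} h_σ(j)·e(y_j ξ/q²) = 0` for `q ∤ ξ`, `= (q/2)·(1 + σ·q·J(−c u | q))` for `ξ = qu`, `q ∤ u`, and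
  `= −q(q−1)/2` for `q² ∣ ξ` (LEAD g14 §2.1: weights `1 + q*` on the class of `σ`, `1 − q*` on the opposite class,
  `q* = J(−1|q)·q`; for a square `c`, `J(−c u | q) = J(−u | q)`: `jacobiSym_neg_sq_mul`); pointwise lemmas
  `isUnit_iff_not_dvd_val`, `sum_units_eq_sum_ite`, `jacobiSym_val_mul_of_mul_mul_eq_neg_one`,
  `jacobiSym_neg_val_eq_of_mul_mul_eq_neg_one`, inner sum `sum_flipWeight_mul_stdAddChar_mod`.

No definitions, no named facts, no `sorry`. beyond-print theorem: NO (finite Fourier analysis; Ramanujan sum + quadratic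
Gauss sum, as in LEAD g14 §2.1's proof).
-/

set_option autoImplicit false
-- summit-side namespace `Summit.BirchSwinnertonDyer.BirchSwinnertonDyer.…` (single-conjunct summit, D-0017 layout)
set_option linter.dupNamespace false

open scoped NumberTheorySymbols
open Complex Finset

namespace Summit.BirchSwinnertonDyer.BirchSwinnertonDyer.Theorems.PrintCFram.FlipRung

/-! ## §4 The cut identity: `(1/q²)·∑_{j mod q²} h_σ(j) e(jn/q²) = 𝟙[q ∥ n ∧ J(n/q | q) = σ]` -/

section CutIdentity

variable (q : ℕ) [Fact q.Prime]

/-- For `i : ZMod q`: `q ∣ i.val ↔ i = 0`. -/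
theorem intCast_dvd_val_iff (i : ZMod q) : ((q : ℤ) ∣ (i.val : ℤ)) ↔ i = 0 := by
  rw [← ZMod.intCast_zmod_eq_zero_iff_dvd]
  simp

/-- `J(u | q) = 0` iff `q ∣ u`, for a prime `q`. -/
theorem jacobiSym_eq_zero_iff_dvd (u : ℤ) : J(u | q) = 0 ↔ (q : ℤ) ∣ u := by
  rw [← jacobiSym.legendreSym.to_jacobiSym, legendreSym.eq_zero_iff, ZMod.intCast_zmod_eq_zero_iff_dvd]

/-- `J(u | q) = ±1` if `q ∤ u`, for a prime `q`. -/
theorem jacobiSym_eq_one_or_of_not_dvd {u : ℤ} (hu : ¬ (q : ℤ) ∣ u) : J(u | q) = 1 ∨ J(u | q) = -1 := by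
  rw [← jacobiSym.legendreSym.to_jacobiSym]
  exact legendreSym.eq_one_or_neg_one q (by rwa [Ne, ZMod.intCast_zmod_eq_zero_iff_dvd])

omit [Fact q.Prime] in
/-- `J(−a | q) = J(−1 | q)·J(a | q)`. -/
theorem jacobiSym_neg_left' (a : ℤ) : J(-a | q) = J(-1 | q) * J(a | q) := by
  rw [neg_eq_neg_one_mul]
  exact jacobiSym.mul_left _ _ _

/-- The inner sum of the cut identity: `∑_{i mod q} h_σ(i) e(iu/q) = ½·((q if q ∤ u else 0) + σ·q·J(u|q))`. -/
theorem sum_legendreClassWeight_mul_stdAddChar_mod (hq2 : q ≠ 2) (σ : ℤ) (u : ℤ) :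
    ∑ i : ZMod q, ((if (q : ℤ) ∣ (i.val : ℤ) then ((q : ℂ) - 1) else -1) + σ * J(-(i.val : ℤ) | q) *
        gaussSum ((quadraticChar (ZMod q)).ringHomComp (Int.castRingHom ℂ)) (ZMod.stdAddChar (N := q))) / 2 *
        ZMod.stdAddChar (i * (u : ZMod q)) =
      ((if (q : ℤ) ∣ u then (0 : ℂ) else (q : ℂ)) + σ * J(u | q) * q) / 2 := by
  set g := gaussSum ((quadraticChar (ZMod q)).ringHomComp (Int.castRingHom ℂ)) (ZMod.stdAddChar (N := q))
    with hg
  have hpt : ∀ i : ZMod q, ((if (q : ℤ) ∣ (i.val : ℤ) then ((q : ℂ) - 1) else -1) + σ * J(-(i.val : ℤ) | q) * g) / 2 *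
      ZMod.stdAddChar (i * (u : ZMod q)) =
      (((if i = 0 then ((q : ℂ) - 1) else 0) - (if i = 0 then (0 : ℂ) else ZMod.stdAddChar (i * (u : ZMod q)))) +
        σ * (J(-1 | q) * g) * ((J((i.val : ℤ) | q) : ℂ) * ZMod.stdAddChar (i * (u : ZMod q)))) / 2 := by
    intro i
    rw [jacobiSym_neg_left']
    by_cases hi : i = 0
    · simp only [intCast_dvd_val_iff, hi, if_true]
      rw [zero_mul, AddChar.map_zero_eq_one]
      push_cast
      ring
    · simp only [intCast_dvd_val_iff, hi, if_false]
      push_cast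
      ring
  simp_rw [hpt]
  rw [← Finset.sum_div, Finset.sum_add_distrib, Finset.sum_sub_distrib, ← Finset.mul_sum, Finset.sum_ite_eq',
    sum_stdAddChar_ne_zero q u, sum_jacobiSym_mul_stdAddChar q hq2 u, ← hg]
  simp only [Finset.mem_univ, if_true]
  have hg2 : J(-1 | q) * g * (J(u | q) * g) = J(u | q) * q := by
    have h1 : (J(-1 | q) : ℂ) ^ 2 = 1 := by exact_mod_cast jacobiSym_neg_one_sq q
    linear_combination (J(u | q) : ℂ) * J(-1 | q) * gaussSum_quadratic_sq q hq2 + (J(u | q) : ℂ) * q * h1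
  split_ifs <;> linear_combination ((σ : ℂ) / 2) * hg2

/-- **The cut identity (Fourier inversion for the Legendre-class cut at `q`).** For an odd prime `q`, `σ = ±1` and `n : ℤ`:
`∑_{j mod q²} (h_σ(j)/q²)·e(jn/q²) = 1` if `q ∥ n` and `J(n/q | q) = σ`, and `= 0` otherwise — i.e. the translate-average
`(1/q²)·∑_j h_σ(j)·f(z + j/q²)` of a `q`-expansion `∑ a(n) e(nz)` is the Legendre cut `P_σ f = ∑_{q ∥ n, J(n/q|q) = σ} a(n) e(nz)`
(LEAD g14 crux notes §2.1; the `b`-vector shape of `PeriodicTwist.exists_modularForm_qExpansion_coeff_eq_mul`). -/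
theorem sum_legendreClassWeight_mul_stdAddChar_sq (hq2 : q ≠ 2) {σ : ℤ} (hσ : σ = 1 ∨ σ = -1) (n : ℤ) :
    ∑ j : ZMod (q ^ 2), ((if (q : ℤ) ∣ (j.val : ℤ) then ((q : ℂ) - 1) else -1) + σ * J(-(j.val : ℤ) | q) *
        gaussSum ((quadraticChar (ZMod q)).ringHomComp (Int.castRingHom ℂ)) (ZMod.stdAddChar (N := q))) / 2 /
        (q : ℂ) ^ 2 * ZMod.stdAddChar (j * (n : ZMod (q ^ 2))) =
      if (q : ℤ) ∣ n ∧ ¬ (q : ℤ) ^ 2 ∣ n ∧ J(n / q | q) = σ then 1 else 0 := by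
  set g := gaussSum ((quadraticChar (ZMod q)).ringHomComp (Int.castRingHom ℂ)) (ZMod.stdAddChar (N := q))
    with hg
  set H : ℕ → ℂ := fun a ↦ ((if (q : ℤ) ∣ (a : ℤ) then ((q : ℂ) - 1) else -1) + σ * J(-(a : ℤ) | q) * g) / 2
    with hH
  have hper : Function.Periodic H q := legendreClassWeight_periodic q σ g
  have hq0 : (q : ℂ) ≠ 0 := Nat.cast_ne_zero.mpr (Nat.Prime.ne_zero Fact.out)
  have hqz : (q : ℤ) ≠ 0 := Nat.cast_ne_zero.mpr (Nat.Prime.ne_zero Fact.out)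
  have hL : ∑ j : ZMod (q ^ 2), ((if (q : ℤ) ∣ (j.val : ℤ) then ((q : ℂ) - 1) else -1) +
      σ * J(-(j.val : ℤ) | q) * g) / 2 / (q : ℂ) ^ 2 * ZMod.stdAddChar (j * (n : ZMod (q ^ 2))) =
      (∑ j : ZMod (q ^ 2), H j.val * ZMod.stdAddChar (j * (n : ZMod (q ^ 2)))) / (q : ℂ) ^ 2 := by
    rw [Finset.sum_div]
    exact Finset.sum_congr rfl fun j _ ↦ by rw [hH]; ring
  rw [hL]
  by_cases hqn : (q : ℤ) ∣ n
  · obtain ⟨u, rfl⟩ := hqn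
    rw [sum_sq_periodic_mul_stdAddChar_of_dvd q H hper u]
    simp only [hH]
    rw [sum_legendreClassWeight_mul_stdAddChar_mod q hq2 σ u, Int.mul_ediv_cancel_left _ hqz]
    have hiff : ((q : ℤ) ^ 2 ∣ (q : ℤ) * u) ↔ ((q : ℤ) ∣ u) := by rw [pow_two, mul_dvd_mul_iff_left hqz]
    have hs2 : (σ : ℂ) ^ 2 = 1 := by rcases hσ with hs | hs <;> simp [hs]
    by_cases hqu : (q : ℤ) ∣ u
    · rw [(jacobiSym_eq_zero_iff_dvd q u).mpr hqu, if_pos hqu, if_neg (by rintro ⟨-, h, -⟩; exact h (hiff.mpr hqu))]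
      simp
    · rw [if_neg hqu]
      by_cases hE : J(u | q) = σ
      · rw [if_pos ⟨dvd_mul_right _ _, fun h ↦ hqu (hiff.mp h), hE⟩, hE]
        field_simp
        linear_combination hs2
      · rw [if_neg (by rintro ⟨-, -, h3⟩; exact hE h3)]
        have hJ : J(u | q) = -σ := by
          rcases jacobiSym_eq_one_or_of_not_dvd q hqu with h | h <;> rcases hσ with hs | hs <;> subst hs <;>
            simp_all
        rw [hJ]
        push_cast
        field_simp
        linear_combination -hs2
  · rw [sum_sq_periodic_mul_stdAddChar_of_not_dvd q H hper hqn, zero_div, if_neg (fun h ↦ hqn h.1)]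

end CutIdentity

/-! ## §5 The flipped-cusp moment `S(ξ) = ∑_{j ∈ (ℤ/q²ℤ)ˣ} h_σ(j)·e(y_j ξ/q²)`, `c·j·y_j ≡ −1 (mod q²)` -/

section FlipMoment

variable (q : ℕ) [Fact q.Prime]

/-- In `ZMod (q²)`, `j` is a unit iff `q ∤ j.val`. -/
theorem isUnit_iff_not_dvd_val (j : ZMod (q ^ 2)) : IsUnit j ↔ ¬ q ∣ j.val := by
  rw [← ZMod.natCast_zmod_val j, ZMod.isUnit_natCast_iff_not_dvd_pow Fact.out two_pos, ZMod.natCast_zmod_val]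

omit [Fact q.Prime] in
/-- Sums over the unit group versus sums over the ring with a unit indicator. -/
theorem sum_units_eq_sum_ite {R : Type*} [CommRing R] [Fintype R] [Fintype Rˣ] [DecidableEq R]
    [DecidablePred (IsUnit : R → Prop)] (F : R → ℂ) :
    ∑ w : Rˣ, F (w : R) = ∑ j : R, if IsUnit j then F j else 0 := by
  rw [← Finset.sum_filter]
  have hmap : (Finset.univ : Finset Rˣ).map ⟨Units.val, Units.val_injective⟩ =
      Finset.univ.filter (IsUnit : R → Prop) := by
    ext j
    simp only [Finset.mem_map, Finset.mem_univ, true_and, Function.Embedding.coeFn_mk, Finset.mem_filter]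
    exact ⟨fun ⟨w, hw⟩ ↦ ⟨w, hw⟩, fun ⟨w, hw⟩ ↦ ⟨w, hw⟩⟩
  rw [← hmap, Finset.sum_map]
  rfl

/-- Reduction mod `q` of a product relation in `ZMod (q²)`, read on Jacobi symbols: if `a·b·d = −1` in `ℤ/q²ℤ` then
`J(a|q)·J(b|q)·J(d|q) = J(−1|q)`. -/
theorem jacobiSym_val_mul_of_mul_mul_eq_neg_one {a b d : ZMod (q ^ 2)} (h : a * b * d = -1) :
    J((a.val : ℤ) | q) * J((b.val : ℤ) | q) * J((d.val : ℤ) | q) = J(-1 | q) := by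
  have hπ := congrArg (ZMod.castHom (dvd_pow_self q two_ne_zero) (ZMod q)) h
  rw [map_mul, map_mul, map_neg, map_one, ZMod.castHom_apply, ZMod.castHom_apply, ZMod.castHom_apply,
    ZMod.cast_eq_val, ZMod.cast_eq_val, ZMod.cast_eq_val] at hπ
  rw [← jacobiSym.mul_left, ← jacobiSym.mul_left, jacobiSym.mod_left, jacobiSym.mod_left (-1)]
  congr 1
  have h2 : (((a.val : ℤ) * b.val * d.val : ℤ) : ZMod q) = ((-1 : ℤ) : ZMod q) := by push_cast; exact_mod_cast hπ
  exact (ZMod.intCast_eq_intCast_iff' _ _ _).mp h2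

/-- The pointwise computation behind the reindexing of `S(ξ)`. -/
theorem jacobiSym_neg_val_eq_of_mul_mul_eq_neg_one {c : ℤ} {x w : ZMod (q ^ 2)}
    (h : (c : ZMod (q ^ 2)) * x * w = -1) :
    J(-(x.val : ℤ) | q) = J(c | q) * J((w.val : ℤ) | q) := by
  have h3 := jacobiSym_val_mul_of_mul_mul_eq_neg_one q h
  have hc : J((((c : ZMod (q ^ 2))).val : ℤ) | q) = J(c | q) := by
    rw [jacobiSym.mod_left, jacobiSym.mod_left c]
    congr 1
    refine (ZMod.intCast_eq_intCast_iff' _ _ _).mp ?_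
    have := map_intCast (ZMod.castHom (dvd_pow_self q two_ne_zero) (ZMod q)) c
    rw [ZMod.castHom_apply, ZMod.cast_eq_val] at this
    exact_mod_cast this
  rw [hc] at h3
  have hx : IsUnit x :=
    IsUnit.of_mul_eq_one (-((c : ZMod (q ^ 2)) * w)) (by linear_combination (-1 : ZMod (q ^ 2)) * h)
  have hxq : ¬ (q : ℤ) ∣ (x.val : ℤ) := by
    rw [Int.natCast_dvd_natCast]; exact (isUnit_iff_not_dvd_val q x).mp hx
  have hx2 : J((x.val : ℤ) | q) ^ 2 = 1 := by
    rcases jacobiSym_eq_one_or_of_not_dvd q hxq with h1 | h1 <;> rw [h1] <;> norm_num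
  rw [jacobiSym_neg_left']
  linear_combination (-J((x.val : ℤ) | q)) * h3 + (J(c | q) * J((w.val : ℤ) | q)) * hx2

/-- The inner sum of the flipped moment: `∑_{i mod q, i ≠ 0} ½(−1 + σ·J(c|q)·J(i|q)·g)·e(iu/q)
 = ½·(−c_q(u) + σ·J(c|q)·J(u|q)·J(−1|q)·q)`. -/
theorem sum_flipWeight_mul_stdAddChar_mod (hq2 : q ≠ 2) (σ c u : ℤ) :
    ∑ i : ZMod q, (if (q : ℤ) ∣ (i.val : ℤ) then (0 : ℂ) else
        (-1 + σ * (J(c | q) * J((i.val : ℤ) | q)) *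
          gaussSum ((quadraticChar (ZMod q)).ringHomComp (Int.castRingHom ℂ)) (ZMod.stdAddChar (N := q))) / 2) *
        ZMod.stdAddChar (i * (u : ZMod q)) =
      (-(if (q : ℤ) ∣ u then ((q : ℂ) - 1) else -1) + σ * J(-(c * u) | q) * q) / 2 := by
  set g := gaussSum ((quadraticChar (ZMod q)).ringHomComp (Int.castRingHom ℂ)) (ZMod.stdAddChar (N := q))
    with hg
  have hpt : ∀ i : ZMod q, (if (q : ℤ) ∣ (i.val : ℤ) then (0 : ℂ) else
      (-1 + σ * (J(c | q) * J((i.val : ℤ) | q)) * g) / 2) * ZMod.stdAddChar (i * (u : ZMod q)) =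
      (-(if i = 0 then (0 : ℂ) else ZMod.stdAddChar (i * (u : ZMod q))) +
        σ * J(c | q) * g * ((J((i.val : ℤ) | q) : ℂ) * ZMod.stdAddChar (i * (u : ZMod q)))) / 2 := by
    intro i
    by_cases hi : i = 0
    · simp only [intCast_dvd_val_iff, hi, if_true, (jacobiSym_val_eq_zero_iff q 0).mpr rfl]
      simp
    · simp only [intCast_dvd_val_iff, hi, if_false]
      ring
  simp_rw [hpt]
  rw [← Finset.sum_div, Finset.sum_add_distrib, Finset.sum_neg_distrib, ← Finset.mul_sum,
    sum_stdAddChar_ne_zero q u, sum_jacobiSym_mul_stdAddChar q hq2 u, ← hg, jacobiSym_neg_left',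
    jacobiSym.mul_left]
  push_cast
  have hg2 : g * (J(u | q) * g) = J(u | q) * (J(-1 | q) * q) := by
    linear_combination (J(u | q) : ℂ) * gaussSum_quadratic_sq q hq2
  linear_combination ((σ : ℂ) * J(c | q) / 2) * hg2

/-- **The flipped-cusp moment `S(ξ)` (LEAD g14 crux notes §2.1).** Let `q` be an odd prime, `σ = ±1`, `c : ℤ`, and for every
`j ∈ (ℤ/q²ℤ)ˣ` let `y_j` satisfy `c·j·y_j = −1` in `ℤ/q²ℤ` (T2's `M²·j·y_j ≡ −1 (mod q²)`, `c = M²`). Then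
`S(ξ) := ∑_{j ∈ (ℤ/q²ℤ)ˣ} h_σ(j)·e(y_j ξ / q²)` equals `0` if `q ∤ ξ`; equals `(q/2)·(1 + σ·q·J(−c u | q))` if `ξ = q u` with
`q ∤ u`; and equals `−q(q−1)/2` if `q² ∣ ξ`. (For `c` a square, `J(−c u | q) = J(−u | q)`: same Legendre class as `σ` carries
the weight `1 + q*`, the opposite class `1 − q*`, `q* = J(−1|q)·q`.) The weight `h_σ` is written in the closed form of
`sum_legendreClass_stdAddChar_eq`; the sum runs over all `j : ZMod (q^2)` with the non-units (`q ∣ j.val`) weighted `0`. -/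
theorem flipMoment_eq (hq2 : q ≠ 2) (σ c : ℤ) (y : ZMod (q ^ 2) → ZMod (q ^ 2))
    (hy : ∀ j : ZMod (q ^ 2), ¬ q ∣ j.val → (c : ZMod (q ^ 2)) * j * y j = -1) (ξ : ℤ) :
    ∑ j : ZMod (q ^ 2), (if q ∣ j.val then (0 : ℂ) else
        ((if (q : ℤ) ∣ (j.val : ℤ) then ((q : ℂ) - 1) else -1) + σ * J(-(j.val : ℤ) | q) *
          gaussSum ((quadraticChar (ZMod q)).ringHomComp (Int.castRingHom ℂ)) (ZMod.stdAddChar (N := q))) / 2 *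
          ZMod.stdAddChar (y j * (ξ : ZMod (q ^ 2)))) =
      if (q : ℤ) ^ 2 ∣ ξ then -((q : ℂ) * ((q : ℂ) - 1)) / 2
      else if (q : ℤ) ∣ ξ then (q : ℂ) * (1 + σ * q * J(-(c * (ξ / q)) | q)) / 2 else 0 := by
  classical
  set g := gaussSum ((quadraticChar (ZMod q)).ringHomComp (Int.castRingHom ℂ)) (ZMod.stdAddChar (N := q))
    with hg
  have hqp : q.Prime := Fact.out
  -- the unit `c`
  have h1 : ¬ q ∣ (1 : ZMod (q ^ 2)).val := (isUnit_iff_not_dvd_val q 1).mp isUnit_one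
  have hcU : IsUnit (c : ZMod (q ^ 2)) :=
    IsUnit.of_mul_eq_one (-(y 1)) (by linear_combination (-1 : ZMod (q ^ 2)) * hy 1 h1)
  set cu := hcU.unit with hcu
  -- Step A: the sum as a sum over the unit group
  set F : ZMod (q ^ 2) → ℂ := fun j ↦ ((if (q : ℤ) ∣ (j.val : ℤ) then ((q : ℂ) - 1) else -1) +
      σ * J(-(j.val : ℤ) | q) * g) / 2 * ZMod.stdAddChar (y j * (ξ : ZMod (q ^ 2))) with hF
  have hA : ∑ j : ZMod (q ^ 2), (if q ∣ j.val then (0 : ℂ) else F j) = ∑ w : (ZMod (q ^ 2))ˣ, F w := by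
    rw [sum_units_eq_sum_ite]
    refine Finset.sum_congr rfl fun j _ ↦ ?_
    by_cases hj : q ∣ j.val
    · rw [if_pos hj, if_neg (fun hu ↦ (isUnit_iff_not_dvd_val q j).mp hu hj)]
    · rw [if_neg hj, if_pos ((isUnit_iff_not_dvd_val q j).mpr hj)]
  -- Step B: reindex by `w ↦ -(c⁻¹ w⁻¹)`
  set e : (ZMod (q ^ 2))ˣ ≃ (ZMod (q ^ 2))ˣ := (Equiv.inv _).trans (Equiv.mulLeft (-cu⁻¹)) with he
  set G : ℕ → ℂ := fun a ↦ if (q : ℤ) ∣ (a : ℤ) then (0 : ℂ) else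
      (-1 + σ * (J(c | q) * J((a : ℤ) | q)) * g) / 2 with hG
  have hB : ∀ w : (ZMod (q ^ 2))ˣ, F (e w) = G (w : ZMod (q ^ 2)).val *
      ZMod.stdAddChar ((w : ZMod (q ^ 2)) * (ξ : ZMod (q ^ 2))) := by
    intro w
    have hew : ((e w : (ZMod (q ^ 2))ˣ) : ZMod (q ^ 2)) = -(((cu⁻¹ : (ZMod (q ^ 2))ˣ) : ZMod (q ^ 2)) *
        ((w⁻¹ : (ZMod (q ^ 2))ˣ) : ZMod (q ^ 2))) := by
      simp [he, Units.val_neg]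
    have hxu : ¬ q ∣ ((e w : (ZMod (q ^ 2))ˣ) : ZMod (q ^ 2)).val :=
      (isUnit_iff_not_dvd_val q _).mp (Units.isUnit _)
    have hyx := hy _ hxu
    -- `c * x = -w⁻¹`, hence `y x = w`
    have hcx : (c : ZMod (q ^ 2)) * ((e w : (ZMod (q ^ 2))ˣ) : ZMod (q ^ 2)) =
        -((w⁻¹ : (ZMod (q ^ 2))ˣ) : ZMod (q ^ 2)) := by
      rw [hew, mul_neg, ← mul_assoc, show (c : ZMod (q ^ 2)) = (cu : ZMod (q ^ 2)) from rfl, Units.mul_inv,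
        one_mul]
    have hyw : y ((e w : (ZMod (q ^ 2))ˣ) : ZMod (q ^ 2)) = (w : ZMod (q ^ 2)) := by
      rw [hcx] at hyx
      have := congrArg (fun t ↦ (w : ZMod (q ^ 2)) * t) hyx
      simp only [neg_mul, mul_neg, ← mul_assoc, Units.mul_inv, one_mul, mul_one] at this
      exact neg_inj.mp this
    have hrel : (c : ZMod (q ^ 2)) * ((e w : (ZMod (q ^ 2))ˣ) : ZMod (q ^ 2)) * (w : ZMod (q ^ 2)) = -1 := by
      rw [← hyw]; exact hyx
    have hJ := jacobiSym_neg_val_eq_of_mul_mul_eq_neg_one q hrel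
    have hwu : ¬ q ∣ (w : ZMod (q ^ 2)).val := (isUnit_iff_not_dvd_val q _).mp (Units.isUnit _)
    rw [hF, hG]
    simp only
    rw [if_neg (by rwa [Int.natCast_dvd_natCast]), if_neg (by rwa [Int.natCast_dvd_natCast]), hJ, hyw]
    push_cast
    ring
  have hGper : Function.Periodic G q := by
    intro a
    simp only [hG]
    have hd : ((q : ℤ) ∣ ((a + q : ℕ) : ℤ)) ↔ ((q : ℤ) ∣ (a : ℤ)) := by
      push_cast; exact dvd_add_left (dvd_refl _)
    have hJ' : J(((a + q : ℕ) : ℤ) | q) = J((a : ℤ) | q) := by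
      rw [jacobiSym.mod_left, jacobiSym.mod_left (a : ℤ)]
      congr 1
      push_cast
      simp
    simp only [hd, hJ']
  -- Step C/D: back to a sum over `ZMod (q²)` and the master lemma
  have hD : ∑ w : (ZMod (q ^ 2))ˣ, F w =
      ∑ x : ZMod (q ^ 2), G x.val * ZMod.stdAddChar (x * (ξ : ZMod (q ^ 2))) := by
    rw [← Fintype.sum_equiv e (fun w ↦ F (e w)) (fun w ↦ F w) (fun _ ↦ rfl)]
    simp_rw [hB]
    rw [sum_units_eq_sum_ite (fun x : ZMod (q ^ 2) ↦ G x.val * ZMod.stdAddChar (x * (ξ : ZMod (q ^ 2))))]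
    refine Finset.sum_congr rfl fun x _ ↦ ?_
    by_cases hx : IsUnit x
    · rw [if_pos hx]
    · rw [if_neg hx, hG]
      simp only
      rw [if_pos (by rw [Int.natCast_dvd_natCast]; exact not_not.mp (mt (isUnit_iff_not_dvd_val q x).mpr hx)),
        zero_mul]
  rw [hA, hD]
  by_cases hqξ : (q : ℤ) ∣ ξ
  · obtain ⟨u, rfl⟩ := hqξ
    have hqz : (q : ℤ) ≠ 0 := Nat.cast_ne_zero.mpr hqp.ne_zero
    rw [sum_sq_periodic_mul_stdAddChar_of_dvd q G hGper u]
    simp only [hG]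
    rw [sum_flipWeight_mul_stdAddChar_mod q hq2 σ c u, Int.mul_ediv_cancel_left _ hqz]
    have hiff : ((q : ℤ) ^ 2 ∣ (q : ℤ) * u) ↔ ((q : ℤ) ∣ u) := by rw [pow_two, mul_dvd_mul_iff_left hqz]
    by_cases hqu : (q : ℤ) ∣ u
    · rw [if_pos hqu, if_pos (hiff.mpr hqu), show J(-(c * u) | q) = 0 from
        (jacobiSym_eq_zero_iff_dvd q _).mpr (dvd_neg.mpr (dvd_mul_of_dvd_right hqu c))]
      push_cast
      ring
    · rw [if_neg hqu, if_neg (fun h ↦ hqu (hiff.mp h)), if_pos (dvd_mul_right _ _)]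
      ring
  · rw [sum_sq_periodic_mul_stdAddChar_of_not_dvd q G hGper hqξ, if_neg (fun h ↦ hqξ ?_), if_neg hqξ]
    exact (dvd_pow_self (q : ℤ) two_ne_zero).trans h

/-- `flipMoment_eq` with INTEGER data: `y : ℤ/q²ℤ → ℤ` with `c·j·y_j ≡ −1 (mod q²)` for `q ∤ j` (the output shape of the
matrix factorisation T2, `c = M²`). -/
theorem flipMoment_eq_int (hq2 : q ≠ 2) (σ c : ℤ) (y : ZMod (q ^ 2) → ℤ)
    (hy : ∀ j : ZMod (q ^ 2), ¬ q ∣ j.val → c * (j.val : ℤ) * y j ≡ -1 [ZMOD ((q ^ 2 : ℕ) : ℤ)]) (ξ : ℤ) :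
    ∑ j : ZMod (q ^ 2), (if q ∣ j.val then (0 : ℂ) else
        ((if (q : ℤ) ∣ (j.val : ℤ) then ((q : ℂ) - 1) else -1) + σ * J(-(j.val : ℤ) | q) *
          gaussSum ((quadraticChar (ZMod q)).ringHomComp (Int.castRingHom ℂ)) (ZMod.stdAddChar (N := q))) / 2 *
          ZMod.stdAddChar (((y j * ξ : ℤ)) : ZMod (q ^ 2))) =
      if (q : ℤ) ^ 2 ∣ ξ then -((q : ℂ) * ((q : ℂ) - 1)) / 2
      else if (q : ℤ) ∣ ξ then (q : ℂ) * (1 + σ * q * J(-(c * (ξ / q)) | q)) / 2 else 0 := by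
  have h := flipMoment_eq q hq2 σ c (fun j ↦ ((y j : ℤ) : ZMod (q ^ 2))) (fun j hj ↦ by
    have := (ZMod.intCast_eq_intCast_iff _ _ _).mpr (hy j hj)
    push_cast at this
    rw [ZMod.natCast_zmod_val] at this
    exact this) ξ
  simp only [Int.cast_mul] at h ⊢
  exact h

end FlipMoment

section Square

variable (q : ℕ) [Fact q.Prime]

omit [Fact q.Prime] in
/-- For `c = M²` a square prime to `q`: `J(−(M²·u) | q) = J(−u | q)` (the weights of `flipMoment_eq` at `c = M²` are
`1 + σ·q·J(−u|q)`, LEAD g14 §2.1 verbatim). -/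
theorem jacobiSym_neg_sq_mul (hq : q.Prime) {M : ℤ} (hM : ¬ (q : ℤ) ∣ M) (u : ℤ) :
    J(-(M ^ 2 * u) | q) = J(-u | q) := by
  have hg : Int.gcd M (q : ℤ) = 1 := by
    rw [Int.gcd_eq_natAbs, Int.natAbs_natCast]
    exact Nat.coprime_comm.mp ((Nat.Prime.coprime_iff_not_dvd hq).mpr (fun h ↦ hM (Int.natCast_dvd.mpr h)))
  rw [show -(M ^ 2 * u) = M ^ 2 * (-u) by ring, jacobiSym.mul_left, jacobiSym.sq_one' hg, one_mul]

omit [Fact q.Prime] in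
/-- Bridge from the matrix-factorisation shape (T2/T3: `j·M·y ≡ b`, `M·b ≡ −1`) to the hypothesis of `flipMoment_eq_int`
(`M²·j·y ≡ −1`). -/
theorem sq_mul_mul_modEq_neg_one {n : ℤ} {M b j y : ℤ} (hMb : M * b ≡ -1 [ZMOD n]) (hy : j * M * y ≡ b [ZMOD n]) :
    M ^ 2 * j * y ≡ -1 [ZMOD n] := by
  have h := hy.mul_left M
  rw [show M * (j * M * y) = M ^ 2 * j * y by ring] at h
  exact h.trans hMb

end Square

end Summit.BirchSwinnertonDyer.BirchSwinnertonDyer.Theorems.PrintCFram.FlipRung
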